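import Summits.QuantumFields.BalabanUV.Beta.WilsonBiStencilWardSocket
import Summits.QuantumFields.BalabanUV.Beta.ColourBasisSU
import Summits.QuantumFields.BalabanUV.Beta.MixedWardPackingFF

/-!
# `BalabanUV.Beta.CombWilsonT2GaugeLetter` — binder row D1, the DICTIONARY's ORDER-2 WILSON LETTER for road «FP» (the (T2-W) table letter PER FINE SITE, COLOUR-FREE):
# **THE LITERAL's UNWEIGHTED SECOND-ORDER WILSON TABLE `T₂ := wilsonW₂ d ((8N²)⁻¹ • wsym22 N)` OBEYS, IN EACH BACKGROUND BOND SLOT AND AT EVERY FINE SITE, THE GAUGE LETTER AGAINST THE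
# UNWEIGHTED FIRST-ORDER WILSON TABLE `wilsonA` WITH CONSTANT `½` — NO REMAINDER** (`SU(N)`, `2 ≤ N`; the per-site colour-free form an3 g104 located as «one `suGen`-instantiation
# away» from leaf-09's `WilsonBiStencilWardSocket.divV_wilsonW₂_wsym22_snd_eq_conjV` ∕ `WilsonBiStencilWardZ.divV_wilsonW₂_wsym22_eq_conjV`, journal W-an3-g104-1 (E))

WHY.  Road «FP»'s graded torus door displays the second-order rows `k2 ∕ a2 ∕ c2 ∕ q2` («OPEN (dictionary)», [D1P3-G19-INBOX-1]); the OWNER d1-p3 g19 ruled (W-FP-19-18) that at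
order 2 representatives are allowed, the price being trace-null remainders (TN).  Of the literal's three second-order TABLE letters only the mixed one carries a remainder
(W-an2-g39-4 ∕ C-2); the Wilson quartic letter is EXACT.  The tree had it block-summed and colour-free (an3's `WilsonWardColourFree.hWil_wilson_TW₃_su`) and per-site WITH colour
data (leaf-09); this file is the per-site colour-free form in the literal's own normalisation — the input shape of the torus periodisation (as leaf-05's `divV_wilsonA_inl_inl` at
order 1 and `CombFormSlotGaugeLetter` for the form slot at levels `j ≥ 1`).
WHAT ([folklore] BY NAME; `T₂ N := wilsonW₂ d ((8N²)⁻¹ • wsym22 N)`; `ρ` any root, the generator symbol `legInd ρ u₀`):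
* §1 generic `d`: **`divV_wilsonT2_fst`** `divV (fun κ u => T₂ κ u κ′ u′) u₀ = ½ • conjV (wilsonA d κ′ u′) (diagK (legInd ρ u₀))` (divergence in the FIRST bond) and **`divV_wilsonT2_snd`**
  `divV (T₂ κ u) u₀ = ½ • conjV (wilsonA d κ u) (diagK (legInd ρ u₀))` (SECOND bond) — leaf-09's laws at the colour basis `suGen N` (`ColourBasisSU.suGen_complete ∕ suGen_trOrthonormal ∕
  diagIndex`), the table factor `(8N²)⁻¹` pulled through `wilsonW₂_smul` ∕ `divV_smul`, and `(8N²)⁻¹·4N² = ½`; entrywise ff forms **`…_inl_inl`**: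
  `= ½ · wilsonA d κ′ u′ x z (inl a) (inl b) · ([z = u₀] − [x = u₀])`.
* §2 in the literal's weights (`cE₂ = Lc^{2(d+1)}` on `T₂`, `cE = Lc^{d+1}` on `wilsonA`): **`divV_wilsonT2_fst_weighted`** ∕ **`_snd_weighted`**:
  `divV (Lc^{2(d+1)} • T₂ …) u₀ = (Lc^{d+1}·½) • conjV (Lc^{d+1} • wilsonA …) (diagK (legInd ρ u₀))` — i.e. per unit FIRST-order weight the second-order Wilson table carries `Lc^{d+1} = cE`
  and the gauge constant is the same `½`: the level-0 (Sd) lock's `ξ = cE·cE′·c₀⁻¹ … = ½` read at order 2.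
WHAT THIS IS NOT: not the torus `k2 ∕ a2` rows (their periodisation is the road's ∕ the leaves'); not the border (T2-B) or mixed (T2-M₂) letters (an1 S2d `SymWardLettersAn1`, the latter with
the remainder `symRMAn1`); not a statement about Bałaban's papers; NOT D1, NOT `BetaPertH`, NOT continuum, NOT Clay.
HONEST FRAMING (cell contract, verbatim): «discharging `BetaPertH` makes Bałaban's UV stability UNCONDITIONAL — a real constructive-QFT
result; it is NOT the continuum limit and NOT the Clay problem.»  HONEST DEPENDENCY: continuum YM on T⁴ ⇐ BetaPertH ∧ nine spine estimates (0/9 proved);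
BetaPertH ⇐ (D1) ∧ (D4) ∧ CAP+tail; G-an2-4 gates asym, D1 and NE2/3/4.
DERIVED cell leaf ([folklore] BY NAME; β sub-cell, BINDER-OWNERS row D1 OWNER `b2b-balaban-beta-an2` gen 39).  No `[cite:]`, no `Prop` fact, no `def`.  Provenance: over leaf-09's
`WilsonBiStencilWardSocket` ∕ `WilsonBiStencilWardZ` (seat d1-formalise-leaf-09 gen 4), an3's `ColourBasisSU` (gen 32) and `PlaquetteStencil`∕`WilsonBiStencil` letters (Literature), an1's
`MixedWardPackingFF.divV_smul` BY NAME; no existing file touched.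
-/

noncomputable section

open Finset
open scoped BigOperators
open Literature.MathematicalPhysics.QuantumFieldTheory
open Literature.MathematicalPhysics.QuantumFieldTheory.Balaban1983to89
open Literature.MathematicalPhysics.QuantumFieldTheory.Balaban1983to89.Beta
open ExpKernelCalculus (MKer comp)
open OneStepResolventKernel (Fib)
open KernelWard (divV)
open StepJetData (wilsonA)
open WilsonBiStencil (wilsonW₂ wilsonW₂_smul)
open WilsonVertex2Sym (wsym22)
open Summit.QuantumFields.BalabanUV.Beta.TameKernelCalculus
open Summit.QuantumFields.BalabanUV.Beta.ChartConjugation (conjV)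
open Summit.QuantumFields.BalabanUV.Beta.BorderedHessian (diagK conjV_diagK_apply)
open Summit.QuantumFields.BalabanUV.Beta.AveragingWardRootedStencils (legInd legInd_inl)
open Summit.QuantumFields.BalabanUV.Beta.ColourBasisSU (suGen suGen_complete suGen_trOrthonormal diagIndex ne_zero_of_two_le)
open Summit.QuantumFields.BalabanUV.Beta.WilsonBiStencilWardSocket (divV_wilsonW₂_wsym22_snd_eq_conjV)
open Summit.QuantumFields.BalabanUV.Beta.WilsonBiStencilWardZ (divV_wilsonW₂_wsym22_eq_conjV)
open Summit.QuantumFields.BalabanUV.Beta.MixedWardPackingFF (divV_smul)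

namespace Summit.QuantumFields.BalabanUV.Beta.CombWilsonT2GaugeLetter

variable {d : ℕ} {N : ℕ}

/-! ## §1 The per-site, colour-free gauge letter of the unweighted second-order Wilson table, both bond slots, constant `½` -/

/-- [folklore] The table constant: `(8N²)⁻¹·(4N²) = ½` (`N ≠ 0`). -/
theorem wilsonTable_const (hN : N ≠ 0) : (8 * (N : ℝ) ^ 2)⁻¹ * (4 * (N : ℝ) ^ 2) = 1 / 2 := by
  have hN' : (N : ℝ) ≠ 0 := by exact_mod_cast hN
  field_simp
  ring

/-- [folklore] **(T2-W) PER FINE SITE, COLOUR-FREE, FIRST BOND SLOT**: for `SU(N)`, `2 ≤ N`, every root `ρ`, every second bond `(κ′, u′)` and every fine site `u₀`,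
`divV (fun κ u => wilsonW₂ d ((8N²)⁻¹ • wsym22 N) κ u κ′ u′) u₀ = ½ • conjV (wilsonA d κ′ u′) (diagK (legInd ρ u₀))`. -/
theorem divV_wilsonT2_fst (hN : 2 ≤ N) (ρ : Fin (d + 1) → ℤ) (κ' : Fin (d + 1)) (u' u₀ : Fin (d + 1) → ℤ) :
    divV (fun κ u => wilsonW₂ d ((8 * (N : ℝ) ^ 2)⁻¹ • wsym22 N) κ u κ' u') u₀ = (1 / 2 : ℝ) • conjV (wilsonA d κ' u') (diagK (legInd ρ u₀)) := by
  have h0 : N ≠ 0 := ne_zero_of_two_le hN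
  have e : (fun κ u => wilsonW₂ d ((8 * (N : ℝ) ^ 2)⁻¹ • wsym22 N) κ u κ' u') =
      fun κ u => (8 * (N : ℝ) ^ 2)⁻¹ • wilsonW₂ d (wsym22 N) κ u κ' u' := by
    funext κ u; exact wilsonW₂_smul _ _ κ u κ' u'
  rw [e, divV_smul, divV_wilsonW₂_wsym22_eq_conjV (suGen_complete h0) (suGen_trOrthonormal N) h0 (diagIndex hN) ρ u' κ' u₀, smul_smul,
    wilsonTable_const h0]

/-- [folklore] **(T2-W) PER FINE SITE, COLOUR-FREE, SECOND BOND SLOT**: `divV (wilsonW₂ d ((8N²)⁻¹ • wsym22 N) κ u) u₀ = ½ • conjV (wilsonA d κ u) (diagK (legInd ρ u₀))`. -/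
theorem divV_wilsonT2_snd (hN : 2 ≤ N) (ρ : Fin (d + 1) → ℤ) (κ : Fin (d + 1)) (u u₀ : Fin (d + 1) → ℤ) :
    divV (wilsonW₂ d ((8 * (N : ℝ) ^ 2)⁻¹ • wsym22 N) κ u) u₀ = (1 / 2 : ℝ) • conjV (wilsonA d κ u) (diagK (legInd ρ u₀)) := by
  have h0 : N ≠ 0 := ne_zero_of_two_le hN
  have e : wilsonW₂ d ((8 * (N : ℝ) ^ 2)⁻¹ • wsym22 N) κ u = fun κ' u' => (8 * (N : ℝ) ^ 2)⁻¹ • wilsonW₂ d (wsym22 N) κ u κ' u' := by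
    funext κ' u'; exact wilsonW₂_smul _ _ κ u κ' u'
  rw [e, divV_smul, divV_wilsonW₂_wsym22_snd_eq_conjV (suGen_complete h0) (suGen_trOrthonormal N) h0 (diagIndex hN) ρ κ u u₀, smul_smul,
    wilsonTable_const h0]

/-- [folklore] First slot, field–field block ENTRYWISE: `= ½ · wilsonA d κ′ u′ x z (inl a) (inl b) · ([z = u₀] − [x = u₀])`. -/
theorem divV_wilsonT2_fst_inl_inl (hN : 2 ≤ N) (κ' : Fin (d + 1)) (u' u₀ x z : Fin (d + 1) → ℤ) (a b : Fin (d + 1)) :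
    divV (fun κ u => wilsonW₂ d ((8 * (N : ℝ) ^ 2)⁻¹ • wsym22 N) κ u κ' u') u₀ x z (Sum.inl a) (Sum.inl b) =
      (1 / 2 : ℝ) * (wilsonA d κ' u' x z (Sum.inl a) (Sum.inl b) * ((if z = u₀ then 1 else 0) - (if x = u₀ then 1 else 0))) := by
  have h := congrFun (congrFun (congrFun (congrFun (divV_wilsonT2_fst (d := d) hN u₀ κ' u' u₀) x) z) (Sum.inl a)) (Sum.inl b)
  rw [h, Pi.smul_apply, Pi.smul_apply, Pi.smul_apply, Pi.smul_apply, smul_eq_mul, conjV_diagK_apply, legInd_inl, legInd_inl]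

/-- [folklore] Second slot, field–field block ENTRYWISE: `= ½ · wilsonA d κ u x z (inl a) (inl b) · ([z = u₀] − [x = u₀])`. -/
theorem divV_wilsonT2_snd_inl_inl (hN : 2 ≤ N) (κ : Fin (d + 1)) (u u₀ x z : Fin (d + 1) → ℤ) (a b : Fin (d + 1)) :
    divV (wilsonW₂ d ((8 * (N : ℝ) ^ 2)⁻¹ • wsym22 N) κ u) u₀ x z (Sum.inl a) (Sum.inl b) =
      (1 / 2 : ℝ) * (wilsonA d κ u x z (Sum.inl a) (Sum.inl b) * ((if z = u₀ then 1 else 0) - (if x = u₀ then 1 else 0))) := by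
  have h := congrFun (congrFun (congrFun (congrFun (divV_wilsonT2_snd (d := d) hN u₀ κ u u₀) x) z) (Sum.inl a)) (Sum.inl b)
  rw [h, Pi.smul_apply, Pi.smul_apply, Pi.smul_apply, Pi.smul_apply, smul_eq_mul, conjV_diagK_apply, legInd_inl, legInd_inl]

/-! ## §2 In the literal's weights: second-order `cE₂ = Lc^{2(d+1)}`, first-order `cE = Lc^{d+1}` — constant `½` per unit first-order weight -/

/-- [folklore] **FIRST SLOT, WEIGHTED**: `divV (fun κ u => Lc^{2(d+1)} • T₂ κ u κ′ u′) u₀ = (Lc^{d+1}·½) • conjV (Lc^{d+1} • wilsonA d κ′ u′) (diagK (legInd ρ u₀))` — the level-0 (Sd) pins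
`(cE, ξ) = (Lc^{d+1}, ½)` read at order 2: the second-order Wilson table carries `cE` per unit first-order weight and the SAME gauge constant `½`. -/
theorem divV_wilsonT2_fst_weighted (hN : 2 ≤ N) (Lc : ℕ) (ρ : Fin (d + 1) → ℤ) (κ' : Fin (d + 1)) (u' u₀ : Fin (d + 1) → ℤ) :
    divV (fun κ u => ((Lc : ℝ) ^ (2 * (d + 1))) • wilsonW₂ d ((8 * (N : ℝ) ^ 2)⁻¹ • wsym22 N) κ u κ' u') u₀ =
      ((Lc : ℝ) ^ (d + 1) * (1 / 2)) • conjV (((Lc : ℝ) ^ (d + 1)) • wilsonA d κ' u') (diagK (legInd ρ u₀)) := by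
  rw [divV_smul, divV_wilsonT2_fst hN ρ κ' u' u₀, smul_smul]
  funext x z a b
  simp only [Pi.smul_apply, smul_eq_mul, conjV_diagK_apply]
  ring

/-- [folklore] **SECOND SLOT, WEIGHTED**: `divV (Lc^{2(d+1)} • T₂ κ u) u₀ = (Lc^{d+1}·½) • conjV (Lc^{d+1} • wilsonA d κ u) (diagK (legInd ρ u₀))`. -/
theorem divV_wilsonT2_snd_weighted (hN : 2 ≤ N) (Lc : ℕ) (ρ : Fin (d + 1) → ℤ) (κ : Fin (d + 1)) (u u₀ : Fin (d + 1) → ℤ) :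
    divV (fun κ' u' => ((Lc : ℝ) ^ (2 * (d + 1))) • wilsonW₂ d ((8 * (N : ℝ) ^ 2)⁻¹ • wsym22 N) κ u κ' u') u₀ =
      ((Lc : ℝ) ^ (d + 1) * (1 / 2)) • conjV (((Lc : ℝ) ^ (d + 1)) • wilsonA d κ u) (diagK (legInd ρ u₀)) := by
  rw [divV_smul, divV_wilsonT2_snd hN ρ κ u u₀, smul_smul]
  funext x z a b
  simp only [Pi.smul_apply, smul_eq_mul, conjV_diagK_apply]
  ring

end Summit.QuantumFields.BalabanUV.Beta.CombWilsonT2GaugeLetter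

end
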